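import Mathlib.NumberTheory.Chebyshev
import Mathlib.Data.Nat.Squarefree
import Mathlib.Data.Nat.Size
import HarnessLib

/-!
# An "almost trivial" lower bound for the number of smooth numbers below a prime

Companion of `PrattCertificates.lean`, feeding the completeness half of the Fellows–Koblitz
deterministic primality test (`FellowsKoblitz.lean`: given the complete factorisation of `p − 1`,
primality of `p` is decided in deterministic polynomial time; Fellows–Koblitz 1992, Lemma 1). That
proof needs, for a prime `p`, *more than `√p` integers `1 ≤ n < p` all of whose prime factors are at
most `(log p)^c`* — de Bruijn's "almost trivial lower bound" for `Ψ(x, y)` (count the products of `u`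
distinct primes `≤ y` with `y^u ≤ x`), quoted by Fellows–Koblitz with `c = 3` and an effective `p₀`.
We prove a crude but fully explicit integer version with `c = 6`, valid for every `p` with at least
`1024` binary digits (no primality needed), in the sub-namespace `SmoothLB`:

* `two_pow_le_succ_mul_pow_primeCounting`: `2^n ≤ (n + 1) · n^{π(n)}` (Chebyshev's lower bound in
  integers, from Mathlib's `Chebyshev.two_pow_le_mul_lcmUpto` and `Nat.lcmUpto_eq_prod_pow_log`);
  `le_two_mul_size_mul_primeCounting`: `n ≤ 2 · size n · π(n)` for `n ≥ 4`;
* `pow_mul_choose_ge`: `n^k ≤ k^k · C(n, k)`; `pow_le_choose_mul`: `t^u ≤ C(t u, u)`;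
* **`exists_smooth_finset`**: if `size p ≥ 1024` there is a finite set `S` of integers `0 < n < p`,
  each with all prime factors `≤ (size p)^6`, with `p < (#S)²`. (Parameters: `m = size p`,
  `L = size m ≥ 11`, `u = ⌊(m − 1) / 6L⌋`; `S` = products of `u`-subsets of the primes `≤ m^6`;
  `#S = C(π(m^6), u) ≥ (m^5 / 2)^u ≥ 2^{(5L − 6) u} ≥ 2^{⌈m/2⌉}`.)

## References

* M. R. Fellows, N. Koblitz, *Self-witnessing polynomial-time complexity and prime factorization*,
  Designs, Codes and Cryptography 2 (1992) 231–235 (also Proc. 7th Structure in Complexity Theory,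
  1992), Lemma 1 and its proof ("the smoothness result we needed is a very weak one … an almost
  trivial lower bound").
* N. G. de Bruijn, *On the number of positive integers `≤ x` and free of prime factors `> y`. II*,
  Indag. Math. 28 (1966) 239–247, §2 (not held; only the elementary counting idea is used, and it is
  proved here from scratch).
-/

namespace Literature.NumberTheory.Primality

namespace SmoothLB

open Nat Finset

/-! ### Chebyshev's lower bound for `π`, in integers -/

/-- **Chebyshev's lower bound in integers**: `2^n ≤ (n + 1) · n^{π(n)}` — the binomial identity
`2^n = Σ C(n, k) ≤ (n + 1) · lcm(1, …, n)` and `lcm(1, …, n) = ∏_{p ≤ n} p^{⌊log_p n⌋} ≤ n^{π(n)}`.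
[cite: FellowsKoblitz1992, Lemma 1 (proof, smoothness estimate)] -/
theorem two_pow_le_succ_mul_pow_primeCounting (n : ℕ) :
    2 ^ n ≤ (n + 1) * n ^ Nat.primeCounting n := by
  rcases Nat.eq_zero_or_pos n with rfl | hn
  · simp
  have h1 := Chebyshev.two_pow_le_mul_lcmUpto n
  have h2 : Nat.lcmUpto n ≤ n ^ Nat.primeCounting n := by
    rw [Nat.lcmUpto_eq_prod_pow_log, ← Nat.primesLE_card_eq_primeCounting]
    exact Finset.prod_le_pow_card _ _ _ fun p _ => Nat.pow_log_le_self p hn.ne'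
  exact h1.trans (Nat.mul_le_mul_left _ h2)

/-- `(n + 1)² < 2^{n+1}` for `n ≥ 4`. [folklore] -/
theorem succ_sq_lt_two_pow_succ {n : ℕ} (hn : 4 ≤ n) : (n + 1) ^ 2 < 2 ^ (n + 1) := by
  induction n, hn using Nat.le_induction with
  | base => norm_num
  | succ n hn ih =>
    have h2 : 2 * n + 3 ≤ 2 ^ (n + 1) := by
      have : n + 2 ≤ 2 ^ n := by
        clear ih
        induction n, hn using Nat.le_induction with
        | base => norm_num
        | succ k hk ihk => rw [pow_succ]; omega
      rw [pow_succ]; omega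
    calc (n + 1 + 1) ^ 2 = (n + 1) ^ 2 + (2 * n + 3) := by ring
      _ < 2 ^ (n + 1) + 2 ^ (n + 1) := Nat.add_lt_add_of_lt_of_le ih h2
      _ = 2 ^ (n + 1 + 1) := by rw [pow_succ 2 (n + 1)]; ring

/-- **`n ≤ 2 · size n · π(n)`** for `n ≥ 4` (`size n = ⌊log₂ n⌋ + 1`): otherwise
`n^{π(n)} < 2^{(n−1)/2}` and `(n + 1)² < 2^{n+1}` contradict `2^n ≤ (n + 1) n^{π(n)}`.
[cite: FellowsKoblitz1992, Lemma 1 (proof, smoothness estimate)] -/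
theorem le_two_mul_size_mul_primeCounting {n : ℕ} (hn : 4 ≤ n) :
    n ≤ 2 * n.size * Nat.primeCounting n := by
  by_contra hlt
  push Not at hlt
  set s := n.size with hs
  set k := Nat.primeCounting n with hk
  have hns : n < 2 ^ s := Nat.lt_size_self n
  -- `n ^ k ≤ 2 ^ (s * k)` and `2 * (s * k) ≤ n - 1`
  have hpow : n ^ k ≤ 2 ^ (s * k) := by
    rw [pow_mul]; exact Nat.pow_le_pow_left hns.le k
  have hsk : 2 * (s * k) + 1 ≤ n := by rw [← Nat.mul_assoc]; omega
  have hmain := two_pow_le_succ_mul_pow_primeCounting n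
  rw [← hk] at hmain
  -- square everything: `(2^n)^2 ≤ (n+1)^2 (n^k)^2 < 2^(n+1) * 2^(n-1) = (2^n)^2`
  have hsq : (2 ^ n) ^ 2 ≤ (n + 1) ^ 2 * (2 ^ (s * k)) ^ 2 := by
    calc (2 ^ n) ^ 2 ≤ ((n + 1) * n ^ k) ^ 2 := Nat.pow_le_pow_left hmain 2
      _ = (n + 1) ^ 2 * (n ^ k) ^ 2 := by ring
      _ ≤ (n + 1) ^ 2 * (2 ^ (s * k)) ^ 2 := Nat.mul_le_mul_left _ (Nat.pow_le_pow_left hpow 2)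
  have h3 : (2 ^ (s * k)) ^ 2 ≤ 2 ^ (n - 1) := by
    rw [← pow_mul]
    exact Nat.pow_le_pow_right two_pos (by omega)
  have h4 := succ_sq_lt_two_pow_succ hn
  have h5 : (n + 1) ^ 2 * (2 ^ (s * k)) ^ 2 < 2 ^ (n + 1) * 2 ^ (n - 1) :=
    Nat.mul_lt_mul_of_lt_of_le h4 h3 (by positivity)
  have h6 : 2 ^ (n + 1) * 2 ^ (n - 1) = (2 ^ n) ^ 2 := by
    rw [← pow_add, ← pow_mul]; congr 1; omega
  rw [h6] at h5
  exact absurd (hsq.trans_lt h5) (lt_irrefl _)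

/-! ### A lower bound for binomial coefficients -/

/-- `n^k ≤ k^k · C(n, k)` for `k ≤ n` (i.e. `(n/k)^k ≤ C(n, k)`), by induction on `k` through
`(n + 1) C(n, k) = C(n + 1, k + 1) (k + 1)`. [folklore] -/
theorem pow_mul_choose_ge : ∀ (k n : ℕ), k ≤ n → n ^ k ≤ k ^ k * n.choose k
  | 0, n, _ => by simp
  | k + 1, n, hkn => by
    obtain ⟨n, rfl⟩ : ∃ n', n = n' + 1 := ⟨n - 1, by omega⟩
    rcases Nat.eq_zero_or_pos k with rfl | hk
    · simp
    have ih := pow_mul_choose_ge k n (by omega)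
    have hid : (n + 1) * n.choose k = (n + 1).choose (k + 1) * (k + 1) := Nat.add_one_mul_choose_eq n k
    -- multiply the goal by `k ^ k > 0`
    have hkpos : 0 < k ^ k := Nat.pow_pos hk
    suffices h : (n + 1) ^ (k + 1) * k ^ k ≤ (k + 1) ^ (k + 1) * (n + 1).choose (k + 1) * k ^ k from
      Nat.le_of_mul_le_mul_right h hkpos
    have step1 : (k + 1) ^ (k + 1) * (n + 1).choose (k + 1) * k ^ k =
        (k + 1) ^ k * (n + 1) * (k ^ k * n.choose k) := by
      calc (k + 1) ^ (k + 1) * (n + 1).choose (k + 1) * k ^ k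
          = (k + 1) ^ k * ((n + 1).choose (k + 1) * (k + 1)) * k ^ k := by ring
        _ = (k + 1) ^ k * ((n + 1) * n.choose k) * k ^ k := by rw [hid]
        _ = (k + 1) ^ k * (n + 1) * (k ^ k * n.choose k) := by ring
    rw [step1]
    have step2 : (k + 1) ^ k * (n + 1) * n ^ k ≤ (k + 1) ^ k * (n + 1) * (k ^ k * n.choose k) :=
      Nat.mul_le_mul_left _ ih
    refine le_trans ?_ step2
    -- `(n+1)^(k+1) k^k ≤ (k+1)^k (n+1) n^k` since `k (n+1) ≤ (k+1) n`
    have hkn' : k * (n + 1) ≤ (k + 1) * n := by nlinarith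
    calc (n + 1) ^ (k + 1) * k ^ k = (n + 1) * (k ^ k * (n + 1) ^ k) := by ring
      _ = (n + 1) * (k * (n + 1)) ^ k := by rw [mul_pow]
      _ ≤ (n + 1) * ((k + 1) * n) ^ k := Nat.mul_le_mul_left _ (Nat.pow_le_pow_left hkn' k)
      _ = (n + 1) * ((k + 1) ^ k * n ^ k) := by rw [mul_pow]
      _ = (k + 1) ^ k * (n + 1) * n ^ k := by ring

/-- `t^u ≤ C(t u, u)`: there are at least `t^u` subsets of size `u` in a set of size `t u`. [folklore] -/
theorem pow_le_choose_mul (t u : ℕ) : t ^ u ≤ (t * u).choose u := by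
  rcases Nat.eq_zero_or_pos u with rfl | hu
  · simp
  rcases Nat.eq_zero_or_pos t with rfl | ht
  · simp [Nat.zero_pow hu]
  have h := pow_mul_choose_ge u (t * u) (Nat.le_mul_of_pos_left u ht)
  rw [mul_pow, mul_comm (t ^ u)] at h
  exact Nat.le_of_mul_le_mul_left h (Nat.pow_pos hu)

/-! ### Products of `u`-sets of small primes -/

/-- The product map on finite sets of primes is injective (unique factorisation:
`primeFactors (∏ A) = A`). [folklore] -/
theorem prod_injOn_of_prime {P : Finset ℕ} (hP : ∀ q ∈ P, q.Prime) (u : ℕ) :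
    Set.InjOn (fun A : Finset ℕ => ∏ q ∈ A, q) (P.powersetCard u : Set (Finset ℕ)) := by
  intro A hA A' hA' h
  have hA1 : ∀ q ∈ A, q.Prime := fun q hq => hP q ((Finset.mem_powersetCard.1 hA).1 hq)
  have hA2 : ∀ q ∈ A', q.Prime := fun q hq => hP q ((Finset.mem_powersetCard.1 hA').1 hq)
  have := congrArg Nat.primeFactors h
  simp only at this
  rwa [Nat.primeFactors_prod hA1, Nat.primeFactors_prod hA2] at this

/-- `2^{L−1} ≥ 2 L²` for `L ≥ 11`. [folklore] -/
theorem two_mul_sq_le_two_pow {L : ℕ} (hL : 11 ≤ L) : 2 * L ^ 2 ≤ 2 ^ (L - 1) := by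
  induction L, hL using Nat.le_induction with
  | base => norm_num
  | succ L hL ih =>
    have h : 2 * (L + 1) ^ 2 ≤ 2 * (2 * L ^ 2) := by nlinarith
    calc 2 * (L + 1) ^ 2 ≤ 2 * (2 * L ^ 2) := h
      _ ≤ 2 * 2 ^ (L - 1) := Nat.mul_le_mul_left 2 ih
      _ = 2 ^ (L + 1 - 1) := by
        rw [← pow_succ']; congr 1; omega

/-- **De Bruijn's almost trivial lower bound, crude explicit form.** If `p` has `m ≥ 1024` binary
digits, there is a finite set `S` of integers `0 < n < p`, each having all its prime factors
`≤ m^6`, with `p < (#S)²`. (`S` = the products of the `u`-element sets of primes `≤ m^6`,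
`u = ⌊(m−1)/(6 size m)⌋`; `#S = C(π(m^6), u) ≥ (m^5/2)^u ≥ 2^{(5 size m − 6) u} ≥ 2^{⌈m/2⌉}` by
`le_two_mul_size_mul_primeCounting` and `pow_le_choose_mul`.) This is the smoothness estimate of
the proof of Fellows–Koblitz's Lemma 1 (there with `log³ p` and an effective `p₀`; here `(size p)⁶`
and `p₀ = 2^1023`). [cite: FellowsKoblitz1992, Lemma 1 (proof, smoothness estimate)] -/
theorem exists_smooth_finset {p : ℕ} (hp : 1024 ≤ p.size) :
    ∃ S : Finset ℕ, p < S.card ^ 2 ∧ ∀ n ∈ S, 0 < n ∧ n < p ∧ ∀ q ∈ n.primeFactors, q ≤ p.size ^ 6 := by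
  -- parameters
  set m := p.size with hm
  set L := m.size with hL
  have hp0 : p ≠ 0 := by rintro rfl; simp [hm] at hp
  have hL11 : 11 ≤ L := by
    rw [hL]; exact Nat.lt_size.2 (le_trans (by norm_num) hp)
  have hmL : 2 ^ (L - 1) ≤ m := by
    apply Nat.lt_size.1; rw [← hL]; omega
  have hmL' : m < 2 ^ L := Nat.lt_size_self m
  have hm2L : 2 * L ^ 2 ≤ m := (two_mul_sq_le_two_pow hL11).trans hmL
  have h6L : 6 * L + 1 ≤ m := by nlinarith
  have hpm : 2 ^ (m - 1) ≤ p := by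
    apply Nat.lt_size.1; rw [← hm]; omega
  have hpm' : p < 2 ^ m := Nat.lt_size_self p
  set u := (m - 1) / (6 * L) with hu
  have h6Lu : 6 * L * u ≤ m - 1 := Nat.mul_div_le (m - 1) (6 * L)
  have h6Lu' : m ≤ 6 * L * u + 6 * L := by
    have := Nat.div_add_mod (m - 1) (6 * L)
    have := Nat.mod_lt (m - 1) (show 0 < 6 * L by omega)
    rw [← hu] at *
    omega
  set B := m ^ 6 with hB
  have hB4 : 4 ≤ B := by
    rw [hB]; calc 4 ≤ 1024 ^ 6 := by norm_num
      _ ≤ m ^ 6 := Nat.pow_le_pow_left hp 6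
  have hBL : B < 2 ^ (6 * L) := by
    rw [hB, pow_mul']
    exact Nat.pow_lt_pow_left hmL' (by norm_num)
  have hsizeB : B.size ≤ 6 * L := Nat.size_le.2 hBL
  have hBp : B < p := by
    refine lt_of_lt_of_le hBL (le_trans (Nat.pow_le_pow_right two_pos ?_) hpm)
    omega
  -- the primes and the sets
  set P := Nat.primesLE B with hP
  have hPprime : ∀ q ∈ P, q.Prime := fun q hq => Nat.prime_of_mem_primesLE hq
  have hPcard : P.card = Nat.primeCounting B := Nat.primesLE_card_eq_primeCounting B
  let f : Finset ℕ → ℕ := fun A => ∏ q ∈ A, q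
  refine ⟨(P.powersetCard u).image f, ?_, ?_⟩
  · -- the count
    rw [Finset.card_image_of_injOn (prod_injOn_of_prime hPprime u), Finset.card_powersetCard, hPcard]
    -- Chebyshev: `B ≤ 2 size B π(B) ≤ 12 L π(B)`
    have hcheb := le_two_mul_size_mul_primeCounting hB4
    set k := Nat.primeCounting B with hk
    have hk12 : B ≤ 12 * L * k := by
      calc B ≤ 2 * B.size * k := hcheb
        _ ≤ 2 * (6 * L) * k := Nat.mul_le_mul_right _ (Nat.mul_le_mul_left _ hsizeB)
        _ = 12 * L * k := by ring
    -- `t u ≤ k` with `t = m^5 / 2`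
    set t := m ^ 5 / 2 with ht
    have htu : t * u ≤ k := by
      have h1 : 12 * L * (t * u) ≤ 6 * L * u * m ^ 5 := by
        have : 2 * t ≤ m ^ 5 := by rw [ht]; omega
        calc 12 * L * (t * u) = 6 * L * u * (2 * t) := by ring
          _ ≤ 6 * L * u * m ^ 5 := Nat.mul_le_mul_left _ this
      have h2 : 6 * L * u * m ^ 5 < m ^ 6 := by
        calc 6 * L * u * m ^ 5 ≤ (m - 1) * m ^ 5 := Nat.mul_le_mul_right _ h6Lu
          _ < m * m ^ 5 := Nat.mul_lt_mul_of_lt_of_le (by omega) le_rfl (by positivity)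
          _ = m ^ 6 := by ring
      have h3 : 12 * L * (t * u) < 12 * L * k := lt_of_lt_of_le (lt_of_le_of_lt h1 h2) hk12
      exact (Nat.lt_of_mul_lt_mul_left h3).le
    -- `C(k, u) ≥ C(t u, u) ≥ t ^ u ≥ 2 ^ ((5L - 6) u)`
    have hchoose : t ^ u ≤ k.choose u := (pow_le_choose_mul t u).trans (Nat.choose_le_choose u htu)
    have ht2 : 2 ^ (5 * L - 6) ≤ t := by
      rw [ht, Nat.le_div_iff_mul_le two_pos]
      calc 2 ^ (5 * L - 6) * 2 = 2 ^ (5 * L - 5) := by rw [← pow_succ]; congr 1; omega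
        _ = (2 ^ (L - 1)) ^ 5 := by rw [← pow_mul]; congr 1; omega
        _ ≤ m ^ 5 := Nat.pow_le_pow_left hmL 5
    have hexp : m ≤ 2 * ((5 * L - 6) * u) := by
      -- `(4L - 12) m ≥ 60 L² - 72 L` from `m ≥ 2 L²`, `L ≥ 11`; then use `6 L u ≥ m - 6 L`
      zify [show 6 ≤ 5 * L by omega] at h6Lu' hm2L hL11 ⊢
      nlinarith [h6Lu', hm2L, hL11]
    calc p < 2 ^ m := hpm'
      _ ≤ 2 ^ (2 * ((5 * L - 6) * u)) := Nat.pow_le_pow_right two_pos hexp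
      _ = ((2 ^ (5 * L - 6)) ^ u) ^ 2 := by rw [← pow_mul, ← pow_mul]; congr 1; ring
      _ ≤ (t ^ u) ^ 2 := Nat.pow_le_pow_left (Nat.pow_le_pow_left ht2 u) 2
      _ ≤ (k.choose u) ^ 2 := Nat.pow_le_pow_left hchoose 2
  · -- the elements
    intro n hn
    obtain ⟨A, hA, rfl⟩ := Finset.mem_image.1 hn
    obtain ⟨hAP, hAcard⟩ := Finset.mem_powersetCard.1 hA
    have hAprime : ∀ q ∈ A, q.Prime := fun q hq => hPprime q (hAP hq)
    have hAle : ∀ q ∈ A, q ≤ B := fun q hq => Nat.le_of_mem_primesLE (hAP hq)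
    refine ⟨Finset.prod_pos fun q hq => (hAprime q hq).pos, ?_, ?_⟩
    · -- `∏ A ≤ B ^ u < p`
      have hle : f A ≤ B ^ u := by
        simpa [f, hAcard] using Finset.prod_le_pow_card A (fun q => q) B hAle
      rcases Nat.eq_zero_or_pos u with hu0 | hupos
      · rw [hu0, pow_zero] at hle
        exact lt_of_le_of_lt hle (lt_of_le_of_lt (by omega : 1 ≤ B) hBp)
      · calc f A ≤ B ^ u := hle
          _ < (2 ^ (6 * L)) ^ u := Nat.pow_lt_pow_left hBL hupos.ne'
          _ = 2 ^ (6 * L * u) := by rw [← pow_mul]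
          _ ≤ 2 ^ (m - 1) := Nat.pow_le_pow_right two_pos h6Lu
          _ ≤ p := hpm
    · intro q hq
      simp only [f] at hq
      rw [Nat.primeFactors_prod hAprime] at hq
      exact hAle q hq

end SmoothLB

end Literature.NumberTheory.Primality
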